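import Mathlib
import Literature.NumberTheory.GaloisRepresentations.PhiGammaModuleRobba
import Literature.NumberTheory.GaloisRepresentations.PstWeilDeligne
import HarnessLib

/-!
# Berger's `D_cris` and `D_st` on `(φ, Γ)`-modules over the Robba ring

Requested notion `BergerDstOnPhiGamma` (item `defn-BergerDstOnPhiGamma`; route
`Langlands/SteinbergWeightVelocity`, crux `DstDictionaryAtP`).  The request: Berger's functors
`D_cris`, `D_st` ON `(φ, Γ)`-modules over `PhiGammaModuleRobba p F E`, the predicates
crystalline / semistable, Ding's two facts the route uses (crystalline criterion for special
extensions, §3.1; the monodromy criterion Lemma 3.2) as predicates, and the comparison with the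
summit's placeholder `PstWeilDeligneData` (`WD ∘ D_pst`).

Berger [Ber02, Thm. 0.2 = Thm. 3.6]: for a `p`-adic representation `V` of `G_K`,
`D_st(V) = (D_log(V)[1/t])^{Γ_K}` and `D_cris(V) = (D_rig(V)[1/t])^{Γ_K}`, where
`D_rig(V)` is the `(φ, Γ_K)`-module over the Robba ring `B_rig,K`, `B_log,K = B_rig,K[log π]`
with `φ(log π) = p log π + log(φ(π)/π^p)`, `γ(log π) = log π + log(γ(π)/π)` (§2.6),
`t = log(1 + π)` with `φ(t) = p t`, `γ(t) = χ(γ) t` (§0.2), and the monodromy `N = -d/d log π`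
(§2.4; renormalised to `N(log π) = -p/(p-1)` to give Fontaine's `N`, [Ber08, §III and the errata
to [Ber02] in its appendix]); `V` is semistable (crystalline) iff this `F`-vector space has
dimension `dim_{ℚ_p} V`.  For a general `(φ, Γ)`-module `D` over the Robba ring the same
formulas DEFINE `D_cris(D)`, `D_st(D)` and "crystalline", "semistable" (as used in
[cite: Ding2019SimpleL, §3.1–3.2]).

The tree's `(φ, Γ)`-rings are abstract (`PhiGammaRing Γ E` of `Trianguline.lean`: a ring `R`
with `φ` and an action of `Γ`; INTENDED the Robba ring), so the elements `t`, `log(φ(π)/π^p)`,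
`log(γ(π)/π)` enter as a DATUM on the ring (`TDatum`, `LogDatum`; Part E pins `φ(t) = p t`,
`σ(t) = χ_cyc(σ) t`, `s = p`, `N(log π) = -p/(p-1)` on the Robba datum), and everything else is
CONSTRUCTED:

* Part A — `PhiGammaRing.IsExtension` (structure maps commuting with `φ`, `Γ`) and
  `PhiGammaModule.extendScalars` (`𝓡' ⊗_𝓡 D` with `φ ⊗ φ_D`, `γ ⊗ γ`, via Mathlib's semilinear
  `TensorProduct.map`).
* Part B — `TDatum` and the `(φ, Γ)`-ring `𝓡.away T = R[1/t]` (`Localization.Away`, the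
  actions extended by `IsLocalization.Away.liftAlgHom`; `t` a non-zero-divisor).
* Part C — `LogDatum` and the `(φ, Γ)`-ring `𝓡.logRing L = R[1/t][log π]` (a type synonym
  `LogDatum.LogRing` of the polynomial ring `R[1/t][X]`, `X = log π`, carrying BERGER's action
  `γ(X) = X + a_γ`, `φ(X) = s X + a_φ` — not Mathlib's coefficientwise action), with the
  monodromy `nLog = ν · d/dX`, and the identities `N γ = γ N`, `N φ = s φ N` PROVED
  (`nLog_smul`, `nLog_frobLog`).
* Part D — stable submodules and quotients of `(φ, Γ)`-modules (`restrict`, `quotient`, the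
  rank-two consecutive subquotients `Triangulation.gradedPair` = Ding's `D_i^{i+1}`);
  **`PhiGammaModule.Dcris T M = (D[1/t])^Γ`**, **`PhiGammaModule.Dst L M = (D[1/t][log π])^Γ`**
  (`E`-submodules of invariants, reusing `PhiGammaModule.invariants`), their Frobenii `phiDcris`,
  `phiDst`, the monodromy **`nDst`** with **`nDst ∘ phiDst = s • phiDst ∘ nDst` PROVED**
  (`nDst_comp_phiDst`), and the predicates `IsCrystalline T f`, `IsSemistable L f`
  (`dim_E = f · rk_R D`, `f` the absolute inertia degree `[F₀:ℚ_p]`, explicit).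
* Part E — `PhiGammaModuleRobbaLog p F E extends PhiGammaModuleRobba p F E` by Berger's
  elements (for `E` a `ℚ_p`-algebra: `χ_cyc` is pushed into `E`), its `tDatum`/`logDatum` and
  the specialisations `𝓣.Dcris`, `𝓣.Dst`, `𝓣.phiDst`, `𝓣.nDst` (`N φ = p φ N`,
  `nDst_comp_phiDst`), `𝓣.IsCrystalline f`, `𝓣.IsSemistable f`; the route's facts as
  PREDICATES ON THE DATUM (nothing asserted, as `HasLiuFiniteness` etc. of
  `PhiGammaModuleRobba.lean`): `HasDingCrystallineCriterion` [cite: Ding2019SimpleL, §3.1],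
  `HasDingMonodromyCriterion` [cite: Ding2019SimpleL, Lemma 3.2], and the monodromy part of the
  comparison with `PstWeilDeligneData`, `IsBergerCompatibleWith`
  [cite: BergerLaurent2002, Thm. 0.2].  `BergerDstOnPhiGamma` is an alias of `PhiGammaModule.Dst`.

## What is deliberately NOT here

* `D_dR` / de Rham `(φ, Γ)`-modules (needs the localisation maps `ι_n : B_rig^{r_n} → K_n[[t]]`,
  [Ber02, §2.2–2.4], a further datum), the filtration on `D_st` ("la recette … suffisamment peu
  ragoûtante pour ne pas être explicitée", [Ber02, §0.2]), and the Frobenius part of the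
  comparison with `WD ∘ D_pst` (needs an embedding `F₀ ↪ ℚ̄_p` and `φ^f`).
* No theorem of the theory is asserted: `dim_E D_cris(D) ≤ f · rk D`, exactness of `D_st` on
  semistable objects, Berger's Thm. A of [Ber08] are not stated as facts.

## Mathlib / Literature declarations used

`PhiGammaRing`, `FramedPhiGammaModule(.toPhiGammaModule, .IsTriangularWith)`,
`PhiGammaModuleData(.Drig)`, `PhiGammaModule(.invariants, .phiInv, .Triangulation, .fil,
.IsStable, .cupOrthogonal, .gradedClass, .ratioParam, .IsNonSplitAt, .ofTriangular)`,
`PhiGammaRing.RankOneDatum(.toModule)`, `PhiGammaModuleRobba(.H2, .H1toH1, .homToH1, .gen,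
.ofChar, .IsCyclotomic)`, `HomCont`, `GaloisRep.cyclotomicCharacter`, `PstWeilDeligneData`,
`WeilDeligneRep`, `Automorphic.HasQlModel`.  Mathlib: `Localization.Away`,
`IsLocalization.Away.liftAlgHom`, `IsLocalization.ringHom_ext`, `Polynomial.(compRingHom,
mapRingHom, derivative, algHom_ext')`, semilinear `TensorProduct.map`, `Submodule.mapQ`,
`LinearMap.(domRestrict, codRestrict, restrict)`, `MulSemiringAction.toAlgHom`.

## References

* L. Berger, *Représentations `p`-adiques et équations différentielles*, Invent. Math. 148
  (2002), 219–284, arXiv:math/0102179 — §0.2 and Thm. 0.2, §1.2, §2.4, §2.6, §3.2 (Thm. 3.6,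
  Prop. 3.7). [BergerLaurent2002]
* L. Berger, *Équations différentielles `p`-adiques et `(φ, N)`-modules filtrés*, Astérisque 319
  (2008), 13–38, arXiv:math/0406601 — §III (`ℓ_X`, `N(ℓ_X) = -p/(p-1)`), Appendix (errata to
  [Ber02]). [Berger2008PhiNFiltres]
* Y. Ding, *Simple `𝓛`-invariants for `GL_n`*, Trans. AMS 372 (2019), arXiv:1807.10862 — §3.1,
  Lemma 3.2. [Ding2019SimpleL]
* K. S. Kedlaya, J. Pottharst, L. Xiao, *Cohomology of arithmetic families of `(φ, Γ)`-modules*,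
  JAMS 27 (2014) — Prop. 6.2.8. [KedlayaPottharstXiao2014]
* J.-M. Fontaine, Astérisque 223 (1994), Exposé VIII (`WD` of a potentially semistable
  representation). [FontaineAsterisque223III]

## Design notes

* `away`, `logRing` are `@[reducible]` so that `(𝓡.away T).R` is seen as `Localization.Away T.t`
  by instance search (the `Algebra 𝓡.R _`, `Module E _`, `IsScalarTower` instances of Mathlib
  apply); the action of `Γ` on `R[1/t]` and on `LogRing` are global instances keyed on the datum.
* `LogRing` is a type synonym because Mathlib equips `R[1/t][X]` with the COEFFICIENTWISE action
  of `Γ`, which is not Berger's; all ring-theoretic identities are proved at the polynomial level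
  (`frobPoly`, `actPoly`, `nPoly`) and transported along the identity `toPoly`.
* Unfolding lemmas on pure tensors are restated for `awayT` / `logAway` (`awayT_act_tmul`, …):
  the generic `extendScalars_act_tmul` is not found by `simp` once `𝓡'.R` reduces to a concrete
  ring (discrimination-tree keys), though `rw` finds it.
* Non-vacuity (scratch, not shipped): a `LogDatum` on the `(φ, Γ)`-ring `ℚ` with
  `Γ = Multiplicative ℤ` acting trivially, `φ = id`, `t = 1`, `a_{γ^n} = n` (so `γ` acts on
  `ℚ[log π]` by `X ↦ X + n`), and `N(ell) = ν` checked.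
-/

noncomputable section

open scoped TensorProduct
open Polynomial

namespace Literature.NumberTheory.GaloisRepresentations

universe u v w w' x

/-! ## Part A. Extension of scalars of `(φ, Γ)`-modules along a map of `(φ, Γ)`-rings -/

namespace PhiGammaRing

variable {Γ : Type u} [Group Γ] {E : Type v} [CommRing E]

/-- `𝓡'` is an **extension of the `(φ, Γ)`-ring `𝓡`**: the structure map `𝓡.R → 𝓡'.R` (an
`Algebra` instance) commutes with the Frobenii and with the actions of `Γ` (e.g. `𝓡 ⊆ 𝓡[1/t]`,
`𝓡 ⊆ 𝓡[1/t][log π]`). [folklore] -/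
class IsExtension (𝓡 : PhiGammaRing.{u, v, w} Γ E) (𝓡' : PhiGammaRing.{u, v, w'} Γ E)
    [Algebra 𝓡.R 𝓡'.R] : Prop where
  /-- The structure map commutes with `φ`. -/
  algebraMap_frob : ∀ r : 𝓡.R, algebraMap 𝓡.R 𝓡'.R (𝓡.frob r) = 𝓡'.frob (algebraMap 𝓡.R 𝓡'.R r)
  /-- The structure map commutes with `Γ`. -/
  algebraMap_smul : ∀ (γ : Γ) (r : 𝓡.R),
    algebraMap 𝓡.R 𝓡'.R (γ • r) = γ • algebraMap 𝓡.R 𝓡'.R r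

attribute [simp] IsExtension.algebraMap_frob IsExtension.algebraMap_smul

/-- `𝓡` is an extension of itself. [folklore] -/
instance IsExtension.refl (𝓡 : PhiGammaRing.{u, v, w} Γ E) : 𝓡.IsExtension 𝓡 where
  algebraMap_frob _ := rfl
  algebraMap_smul _ _ := rfl

variable (𝓡 : PhiGammaRing.{u, v, w} Γ E) (𝓡' : PhiGammaRing.{u, v, w'} Γ E)
  [Algebra 𝓡.R 𝓡'.R] [𝓡.IsExtension 𝓡']

/-- The Frobenius of an extension `𝓡'` of `𝓡`, as a `φ`-semilinear map of `𝓡.R`-modules.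
[folklore] -/
def frobₛₗ : 𝓡'.R →ₛₗ[(𝓡.frob : 𝓡.R →+* 𝓡.R)] 𝓡'.R where
  toFun := 𝓡'.frob
  map_add' := map_add _
  map_smul' r x := by
    rw [Algebra.smul_def, map_mul, RingHom.coe_coe, Algebra.smul_def,
      IsExtension.algebraMap_frob]

/-- Unfolding lemma for `frobₛₗ`. [folklore] -/
@[simp] lemma frobₛₗ_apply (x : 𝓡'.R) : frobₛₗ 𝓡 𝓡' x = 𝓡'.frob x := rfl

/-- The action of `γ ∈ Γ` on an extension `𝓡'` of `𝓡`, as a `γ`-semilinear map of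
`𝓡.R`-modules. [folklore] -/
def actₛₗ (γ : Γ) : 𝓡'.R →ₛₗ[(MulSemiringAction.toRingHom Γ 𝓡.R γ)] 𝓡'.R where
  toFun x := γ • x
  map_add' := smul_add γ
  map_smul' r x := by
    rw [Algebra.smul_def, smul_mul', MulSemiringAction.toRingHom_apply, Algebra.smul_def,
      IsExtension.algebraMap_smul]

/-- Unfolding lemma for `actₛₗ`. [folklore] -/
@[simp] lemma actₛₗ_apply (γ : Γ) (x : 𝓡'.R) : actₛₗ 𝓡 𝓡' γ x = γ • x := rfl

end PhiGammaRing

namespace PhiGammaModule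

variable {Γ : Type u} [Group Γ] {E : Type v} [CommRing E] {𝓡 : PhiGammaRing.{u, v, w} Γ E}
  {D : Type x} [AddCommGroup D] [Module 𝓡.R D] (M : PhiGammaModule 𝓡 D)

/-- `φ_D` as a `φ`-semilinear map. [folklore] -/
def phiₛₗ : D →ₛₗ[(𝓡.frob : 𝓡.R →+* 𝓡.R)] D where
  toFun := M.phi
  map_add' := map_add _
  map_smul' := M.phi_smul

/-- Unfolding lemma for `phiₛₗ`. [folklore] -/
@[simp] lemma phiₛₗ_apply (x : D) : M.phiₛₗ x = M.phi x := rfl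

/-- The action of `γ` on `D` as a `γ`-semilinear map. [folklore] -/
def actₛₗ (γ : Γ) : D →ₛₗ[(MulSemiringAction.toRingHom Γ 𝓡.R γ)] D where
  toFun := M.act γ
  map_add' := map_add _
  map_smul' := M.act_smul γ

/-- Unfolding lemma for `actₛₗ`. [folklore] -/
@[simp] lemma actₛₗ_apply (γ : Γ) (x : D) : M.actₛₗ γ x = M.act γ x := rfl

variable (𝓡' : PhiGammaRing.{u, v, w'} Γ E) [Algebra 𝓡.R 𝓡'.R] [𝓡.IsExtension 𝓡']

/-- **Extension of scalars** `𝓡' ⊗_𝓡 D` of a `(φ, Γ)`-module along an extension of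
`(φ, Γ)`-rings: `φ(r' ⊗ x) = φ(r') ⊗ φ_D(x)`, `γ(r' ⊗ x) = γ(r') ⊗ γ(x)` (e.g.
`D ↦ D[1/t] = 𝓡[1/t] ⊗_𝓡 D`, `D ↦ 𝓡[log π, 1/t] ⊗_𝓡 D`).
[cite: BergerLaurent2002, §3.2 (the modules `D_rig(V)`, `D_log(V)`)] -/
def extendScalars : PhiGammaModule 𝓡' (𝓡'.R ⊗[𝓡.R] D) where
  phi := (TensorProduct.map (PhiGammaRing.frobₛₗ 𝓡 𝓡') M.phiₛₗ).toAddMonoidHom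
  phi_smul r z := by
    induction z using TensorProduct.induction_on with
    | zero => simp
    | tmul a x =>
      simp only [LinearMap.toAddMonoidHom_coe, TensorProduct.smul_tmul', smul_eq_mul,
        TensorProduct.map_tmul, PhiGammaRing.frobₛₗ_apply, map_mul, phiₛₗ_apply]
    | add z z' hz hz' => simp only [smul_add, map_add, hz, hz']
  act γ := (TensorProduct.map (PhiGammaRing.actₛₗ 𝓡 𝓡' γ) (M.actₛₗ γ)).toAddMonoidHom
  act_one := by
    refine AddMonoidHom.ext fun z => ?_
    induction z using TensorProduct.induction_on with
    | zero => simp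
    | tmul a x => simp
    | add z z' hz hz' => rw [map_add, hz, hz']; rfl
  act_mul γ γ' := by
    refine AddMonoidHom.ext fun z => ?_
    induction z using TensorProduct.induction_on with
    | zero => simp
    | tmul a x => simp [mul_smul, act_mul_apply]
    | add z z' hz hz' => rw [map_add, hz, hz', AddMonoidHom.comp_apply, map_add]; rfl
  act_smul γ r z := by
    induction z using TensorProduct.induction_on with
    | zero => simp
    | tmul a x =>
      simp only [LinearMap.toAddMonoidHom_coe, TensorProduct.smul_tmul', smul_eq_mul,
        TensorProduct.map_tmul, PhiGammaRing.actₛₗ_apply, smul_mul', actₛₗ_apply]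
    | add z z' hz hz' => simp only [smul_add, map_add, hz, hz']
  phi_act γ z := by
    induction z using TensorProduct.induction_on with
    | zero => simp
    | tmul a x => simp [𝓡'.frob_smul, M.phi_act]
    | add z z' hz hz' => simp only [map_add, hz, hz']

/-- Unfolding lemma: `φ(r' ⊗ x) = φ(r') ⊗ φ_D(x)`. [folklore] -/
@[simp] lemma extendScalars_phi_tmul (a : 𝓡'.R) (x : D) :
    (M.extendScalars 𝓡').phi (a ⊗ₜ x) = 𝓡'.frob a ⊗ₜ M.phi x := rfl

/-- Unfolding lemma: `γ(r' ⊗ x) = γ(r') ⊗ γ(x)`. [folklore] -/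
@[simp] lemma extendScalars_act_tmul (γ : Γ) (a : 𝓡'.R) (x : D) :
    (M.extendScalars 𝓡').act γ (a ⊗ₜ x) = (γ • a) ⊗ₜ M.act γ x := rfl

end PhiGammaModule

/-! ## Part B. Berger's element `t` and the `(φ, Γ)`-ring `𝓡[1/t]` -/

namespace PhiGammaRing

variable {Γ : Type u} [Group Γ] {E : Type v} [CommRing E] (𝓡 : PhiGammaRing.{u, v, w} Γ E)

namespace RankOneDatum

variable {𝓡}

/-- The **constant rank-one datum** of units `α ∈ Eˣ`, `c : Γ →* Eˣ` of the coefficients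
(`φ(e) = α e`, `γ(e) = c(γ) e`; the relations hold because `φ` and `Γ` fix `E`): for `F = ℚ_p`
every `𝓡(δ)` is of this form (`α = δ(p)`, `c = δ ∘ χ`), and Berger's `t = log(1 + π)` spans the
constant datum `α = p`, `c = χ_cyc`. [cite: KedlayaPottharstXiao2014, Notation 6.2.2],
[cite: BergerLaurent2002, §0.2 (`γ(t) = χ(γ) t`, `φ(t) = p t`)] -/
def const (α : Eˣ) (c : Γ →* Eˣ) : 𝓡.RankOneDatum where
  α := Units.map (algebraMap E 𝓡.R : E →* 𝓡.R) α
  c γ := Units.map (algebraMap E 𝓡.R : E →* 𝓡.R) (c γ)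
  c_mul γ γ' := by simp
  compat γ := by
    simp only [Units.coe_map, MonoidHom.coe_coe, smul_algebraMap_eq, AlgHom.commutes]
    ring

/-- Unfolding lemma for the `α` of a constant datum. [folklore] -/
@[simp] lemma const_α (α : Eˣ) (c : Γ →* Eˣ) :
    ((const α c : 𝓡.RankOneDatum).α : 𝓡.R) = algebraMap E 𝓡.R α := rfl

/-- Unfolding lemma for the `c` of a constant datum. [folklore] -/
@[simp] lemma const_c (α : Eˣ) (c : Γ →* Eˣ) (γ : Γ) :
    ((const α c : 𝓡.RankOneDatum).c γ : 𝓡.R) = algebraMap E 𝓡.R (c γ) := rfl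

end RankOneDatum

/-- **Berger's element `t`** on a `(φ, Γ)`-ring, as a datum: a non-zero-divisor `t ∈ R` spanning a
`φ`- and `Γ`-stable line, `φ(t) = α t` and `γ(t) = c_γ t` for the units `(α, c)` of a rank-one
datum `scalars` (INTENDED: the Robba ring `𝓡_E(π_F)` with `t = log(1 + π)`, `α = p`,
`c_γ = χ_cyc(γ)`; `t` is a non-zero-divisor of the Robba ring).  This is exactly what is needed
to extend `φ` and `Γ` to `R[1/t]`. [cite: BergerLaurent2002, §0.2 and Thm. 0.2] -/
structure TDatum where
  /-- The element `t` (intended: `log(1 + π) = log [ε]`). -/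
  t : 𝓡.R
  /-- `t` is a non-zero-divisor (so that `R → R[1/t]` is injective and `R[1/t] ≠ 0`). -/
  t_mem : t ∈ nonZeroDivisors 𝓡.R
  /-- The units `(α, c)` with `φ(t) = α t`, `γ(t) = c_γ t` (intended: `α = p`, `c = χ_cyc`). -/
  scalars : 𝓡.RankOneDatum
  /-- `φ(t) = α t` (intended: `φ(t) = p t`). -/
  frob_t : 𝓡.frob t = (scalars.α : 𝓡.R) * t
  /-- `γ(t) = c_γ t` (intended: `γ(t) = χ_cyc(γ) t`). -/
  smul_t : ∀ γ : Γ, γ • t = (scalars.c γ : 𝓡.R) * t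

namespace TDatum

variable {𝓡} (T : 𝓡.TDatum)

/-- The ring `R[1/t]` (localisation away from `t`). [cite: BergerLaurent2002, Thm. 0.2] -/
abbrev Rt : Type w := Localization.Away T.t

/-- `R → R[1/t]` is injective (`t` is a non-zero-divisor). [folklore] -/
lemma algebraMap_injective : Function.Injective (algebraMap 𝓡.R T.Rt) :=
  IsLocalization.injective T.Rt (Submonoid.powers_le.2 T.t_mem)

/-- `R[1/t] ≠ 0` (`t` is a non-zero-divisor of the nontrivial ring `R`). [folklore] -/
instance nontrivial_Rt : Nontrivial T.Rt := T.algebraMap_injective.nontrivial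

/-- `φ(t) = α t` is a unit of `R[1/t]`. [folklore] -/
lemma isUnit_algebraMap_frob_t : IsUnit (algebraMap 𝓡.R T.Rt (𝓡.frob T.t)) := by
  rw [T.frob_t, map_mul]
  exact (T.scalars.α.isUnit.map _).mul (IsLocalization.Away.algebraMap_isUnit T.t)

/-- `γ(t) = c_γ t` is a unit of `R[1/t]`. [folklore] -/
lemma isUnit_algebraMap_smul_t (γ : Γ) : IsUnit (algebraMap 𝓡.R T.Rt (γ • T.t)) := by
  rw [T.smul_t, map_mul]
  exact ((T.scalars.c γ).isUnit.map _).mul (IsLocalization.Away.algebraMap_isUnit T.t)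

/-- The Frobenius of `R[1/t]`: the unique ring endomorphism extending `φ` (`φ(t) = α t` is
invertible in `R[1/t]`). [cite: BergerLaurent2002, §0.2] -/
def frobRt : T.Rt →ₐ[E] T.Rt :=
  IsLocalization.Away.liftAlgHom T.t
    (f := (IsScalarTower.toAlgHom E 𝓡.R T.Rt).comp 𝓡.frob) T.isUnit_algebraMap_frob_t

/-- `φ` on `R[1/t]` extends `φ` on `R`. [folklore] -/
@[simp] lemma frobRt_algebraMap (r : 𝓡.R) :
    T.frobRt (algebraMap 𝓡.R T.Rt r) = algebraMap 𝓡.R T.Rt (𝓡.frob r) := by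
  rw [frobRt, IsLocalization.Away.liftAlgHom_apply, IsLocalization.Away.lift_eq]
  rfl

/-- The action of `γ ∈ Γ` on `R[1/t]`: the unique ring endomorphism extending `γ` on `R`
(`γ(t) = c_γ t` is invertible in `R[1/t]`). [cite: BergerLaurent2002, §0.2] -/
def actRt (γ : Γ) : T.Rt →ₐ[E] T.Rt :=
  IsLocalization.Away.liftAlgHom T.t
    (f := (IsScalarTower.toAlgHom E 𝓡.R T.Rt).comp (MulSemiringAction.toAlgHom E 𝓡.R γ))
    (T.isUnit_algebraMap_smul_t γ)

/-- `γ` on `R[1/t]` extends `γ` on `R`. [folklore] -/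
@[simp] lemma actRt_algebraMap (γ : Γ) (r : 𝓡.R) :
    T.actRt γ (algebraMap 𝓡.R T.Rt r) = algebraMap 𝓡.R T.Rt (γ • r) := by
  rw [actRt, IsLocalization.Away.liftAlgHom_apply, IsLocalization.Away.lift_eq]
  rfl

/-- `1 ∈ Γ` acts trivially on `R[1/t]`. [folklore] -/
lemma actRt_one : T.actRt 1 = AlgHom.id E T.Rt :=
  AlgHom.coe_ringHom_injective
    (IsLocalization.ringHom_ext (Submonoid.powers T.t) (RingHom.ext fun r => by simp))

/-- `γγ'` acts as `γ ∘ γ'` on `R[1/t]`. [folklore] -/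
lemma actRt_mul (γ γ' : Γ) : T.actRt (γ * γ') = (T.actRt γ).comp (T.actRt γ') :=
  AlgHom.coe_ringHom_injective
    (IsLocalization.ringHom_ext (Submonoid.powers T.t) (RingHom.ext fun r => by simp [mul_smul]))

/-- **The action of `Γ` on `R[1/t]`** by the extended ring automorphisms `actRt`.
[cite: BergerLaurent2002, §0.2] -/
instance mulSemiringAction_Rt : MulSemiringAction Γ T.Rt where
  smul γ x := T.actRt γ x
  one_smul x := show T.actRt 1 x = x by rw [actRt_one]; rfl
  mul_smul γ γ' x := show T.actRt (γ * γ') x = T.actRt γ (T.actRt γ' x) by rw [actRt_mul]; rfl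
  smul_zero γ := map_zero (T.actRt γ)
  smul_add γ := map_add (T.actRt γ)
  smul_one γ := map_one (T.actRt γ)
  smul_mul γ := map_mul (T.actRt γ)

/-- Unfolding lemma: `γ` acts on `R[1/t]` through `actRt`. [folklore] -/
lemma smul_def (γ : Γ) (x : T.Rt) : γ • x = T.actRt γ x := rfl

/-- `γ(r/1) = γ(r)/1`. [folklore] -/
@[simp] lemma smul_algebraMap (γ : Γ) (r : 𝓡.R) :
    γ • algebraMap 𝓡.R T.Rt r = algebraMap 𝓡.R T.Rt (γ • r) := by
  rw [smul_def, actRt_algebraMap]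

/-- The action of `Γ` on `R[1/t]` is `E`-linear. [folklore] -/
instance smulCommClass_Rt : SMulCommClass Γ E T.Rt where
  smul_comm γ e x := by rw [smul_def, smul_def, map_smul]

/-- `φ` commutes with `Γ` on `R[1/t]` (both composites extend `r ↦ φ(γ r) = γ φ(r)`). [folklore] -/
lemma frobRt_smul (γ : Γ) (x : T.Rt) : T.frobRt (γ • x) = γ • T.frobRt x := by
  have h : (T.frobRt : T.Rt →+* T.Rt).comp (T.actRt γ : T.Rt →+* T.Rt) =
      (T.actRt γ : T.Rt →+* T.Rt).comp (T.frobRt : T.Rt →+* T.Rt) :=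
    IsLocalization.ringHom_ext (Submonoid.powers T.t) (RingHom.ext fun r => by
      simp [𝓡.frob_smul])
  exact RingHom.congr_fun h x

/-- The inverse `1/t ∈ R[1/t]`. [folklore] -/
def tInv : T.Rt := IsLocalization.Away.invSelf T.t

/-- `t · (1/t) = 1` in `R[1/t]`. [folklore] -/
@[simp] lemma algebraMap_t_mul_tInv : algebraMap 𝓡.R T.Rt T.t * T.tInv = 1 :=
  IsLocalization.Away.mul_invSelf T.t

end TDatum

/-- **The `(φ, Γ)`-ring `𝓡[1/t]`**: the localisation of `R` away from Berger's `t`, with the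
unique extensions of `φ` and of the action of `Γ` (Berger: `D_cris(V) = (D_rig(V)[1/t])^{Γ_K}`).
Reducible, so that `(𝓡.away T).R` is SEEN as `Localization.Away T.t` by instance search.
[cite: BergerLaurent2002, Thm. 0.2] -/
@[reducible] def away (T : 𝓡.TDatum) : PhiGammaRing.{u, v, w} Γ E where
  R := T.Rt
  frob := T.frobRt
  frob_smul := T.frobRt_smul

/-- Unfolding lemma: the Frobenius of `𝓡[1/t]` is `frobRt`. [folklore] -/
@[simp] lemma away_frob_apply (T : 𝓡.TDatum) (x : T.Rt) : (𝓡.away T).frob x = T.frobRt x := rfl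

/-- `𝓡[1/t]` is an extension of `𝓡` (`φ` and `Γ` are extended). [folklore] -/
instance isExtension_away (T : 𝓡.TDatum) : 𝓡.IsExtension (𝓡.away T) where
  algebraMap_frob r := (T.frobRt_algebraMap r).symm
  algebraMap_smul γ r := (T.smul_algebraMap γ r).symm

/-! ## Part C. The log datum and the `(φ, Γ, N)`-ring `𝓡[1/t][log π]` -/

/-- **Berger's log structure** on a `(φ, Γ)`-ring: Berger's `t` (a `TDatum`) together with the
data defining the ring `B_log = B_rig[log π]` — a variable `ℓ = log π` with
`φ(ℓ) = s ℓ + a_φ`, `γ(ℓ) = ℓ + a_γ` (INTENDED: `s = p`, `a_φ = log(φ(π)/π^p) ∈ R`,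
`a_γ = log(γ(π)/π) ∈ R`, Berger 2002 §2.6; Berger 2008 §III: "`φ(ℓ_X) = p ℓ_X + log(φ(X)/X^p)`,
`γ(ℓ_X) = ℓ_X + log(γ(X)/X)`") subject to the two relations making this a commuting pair of
actions (`a` is a crossed homomorphism; `γ(φ(ℓ)) = φ(γ(ℓ))`), and the scalar `ν = N(ℓ)`
normalising the monodromy `N = ν · d/dℓ` (Berger 2002 §2.4: `N = -d/d log π`, i.e. `ν = -1`;
to recover Fontaine's `D_st` one must take `ν = -p/(p-1)`, Berger 2008 §III and the erratum to
[Ber02] in its appendix). [cite: BergerLaurent2002, §2.4 and §2.6],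
[cite: Berger2008PhiNFiltres, §III (definition of `ℓ_X`, `N(ℓ_X) = -p/(p-1)`) and Appendix (errata to [Ber02])] -/
structure LogDatum extends TDatum 𝓡 where
  /-- The scalar `s` with `φ(ℓ) = s ℓ + a_φ` (intended: `s = p`). -/
  s : E
  /-- `a_φ = φ(ℓ) - s ℓ` (intended: `log(φ(π)/π^p)`). -/
  aφ : 𝓡.R
  /-- `a_γ = γ(ℓ) - ℓ` (intended: `log(γ(π)/π)`). -/
  a : Γ → 𝓡.R
  /-- `a` is a crossed homomorphism: `a_{γγ'} = a_γ + γ(a_{γ'})` (so that `Γ` acts on `R[ℓ]`). -/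
  a_mul : ∀ γ γ' : Γ, a (γ * γ') = a γ + γ • a γ'
  /-- `γ(φ(ℓ)) = φ(γ(ℓ))`: `s a_γ + γ(a_φ) = a_φ + φ(a_γ)`. -/
  frob_a : ∀ γ : Γ, s • a γ + γ • aφ = aφ + 𝓡.frob (a γ)
  /-- `ν = N(ℓ)` (intended: `-p/(p-1)`; Berger 2002 prints `-1`). -/
  ν : E

namespace LogDatum

variable {𝓡} (L : 𝓡.LogDatum)

/-- `a_1 = 0`. [folklore] -/
@[simp] lemma a_one : L.a 1 = 0 := by
  have h := L.a_mul 1 1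
  rw [mul_one, one_smul] at h
  simpa using h

/-! ### Polynomial level: `φ`, `γ`, `N` on `R[1/t][X]` (`X = ℓ = log π`) -/

/-- `φ(ℓ) = s ℓ + a_φ`, as a polynomial over `R[1/t]`. [cite: BergerLaurent2002, §2.6] -/
def frobX : (L.Rt)[X] := C (algebraMap E L.Rt L.s) * X + C (algebraMap 𝓡.R L.Rt L.aφ)

/-- `γ(ℓ) = ℓ + a_γ`, as a polynomial over `R[1/t]`. [cite: BergerLaurent2002, §2.6] -/
def actX (γ : Γ) : (L.Rt)[X] := X + C (algebraMap 𝓡.R L.Rt (L.a γ))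

/-- The Frobenius of `R[1/t][ℓ]`: `φ` on the coefficients and `ℓ ↦ s ℓ + a_φ`, i.e.
`x ↦ x^φ ∘ (s ℓ + a_φ)`. [cite: BergerLaurent2002, §2.6] -/
def frobPoly : (L.Rt)[X] →ₐ[E] (L.Rt)[X] where
  toRingHom := (Polynomial.compRingHom L.frobX).comp
    (Polynomial.mapRingHom (L.frobRt : L.Rt →+* L.Rt))
  commutes' e := by simp [Polynomial.algebraMap_apply]

/-- Unfolding lemma for `frobPoly`. [folklore] -/
lemma frobPoly_apply (x : (L.Rt)[X]) :
    L.frobPoly x = (x.map (L.frobRt : L.Rt →+* L.Rt)).comp L.frobX := rfl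

/-- `φ(C r) = C(φ r)`. [folklore] -/
@[simp] lemma frobPoly_C (r : L.Rt) : L.frobPoly (C r) = C (L.frobRt r) := by
  simp [frobPoly_apply]

/-- `φ(ℓ) = s ℓ + a_φ`. [cite: BergerLaurent2002, §2.6] -/
@[simp] lemma frobPoly_X :
    L.frobPoly X = C (algebraMap E L.Rt L.s) * X + C (algebraMap 𝓡.R L.Rt L.aφ) := by
  simp [frobPoly_apply, frobX]

/-- The action of `γ` on `R[1/t][ℓ]`: `γ` on the coefficients and `ℓ ↦ ℓ + a_γ`.
[cite: BergerLaurent2002, §2.6] -/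
def actPoly (γ : Γ) : (L.Rt)[X] →ₐ[E] (L.Rt)[X] where
  toRingHom := (Polynomial.compRingHom (L.actX γ)).comp
    (Polynomial.mapRingHom (L.actRt γ : L.Rt →+* L.Rt))
  commutes' e := by simp [Polynomial.algebraMap_apply]

/-- Unfolding lemma for `actPoly`. [folklore] -/
lemma actPoly_apply (γ : Γ) (x : (L.Rt)[X]) :
    L.actPoly γ x = (x.map (L.actRt γ : L.Rt →+* L.Rt)).comp (L.actX γ) := rfl

/-- `γ(C r) = C(γ r)`. [folklore] -/
@[simp] lemma actPoly_C (γ : Γ) (r : L.Rt) : L.actPoly γ (C r) = C (γ • r) := by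
  simp [actPoly_apply, TDatum.smul_def]

/-- `γ(ℓ) = ℓ + a_γ`. [cite: BergerLaurent2002, §2.6] -/
@[simp] lemma actPoly_X (γ : Γ) : L.actPoly γ X = X + C (algebraMap 𝓡.R L.Rt (L.a γ)) := by
  simp [actPoly_apply, actX]

/-- `1 ∈ Γ` acts trivially on `R[1/t][ℓ]`. [folklore] -/
lemma actPoly_one : L.actPoly 1 = AlgHom.id E (L.Rt)[X] :=
  Polynomial.algHom_ext' (AlgHom.ext fun r => by simp) (by simp)

/-- `γγ'` acts as `γ ∘ γ'` on `R[1/t][ℓ]` (uses the crossed-homomorphism relation). [folklore] -/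
lemma actPoly_mul (γ γ' : Γ) : L.actPoly (γ * γ') = (L.actPoly γ).comp (L.actPoly γ') :=
  Polynomial.algHom_ext' (AlgHom.ext fun r => by simp [mul_smul]) (by
    simp only [actPoly_X, AlgHom.coe_comp, Function.comp_apply, map_add, actPoly_C,
      TDatum.smul_algebraMap, L.a_mul]
    ring)

/-- `φ` commutes with `γ` on `R[1/t][ℓ]` (uses `s a_γ + γ(a_φ) = a_φ + φ(a_γ)`). [folklore] -/
lemma frobPoly_actPoly (γ : Γ) (x : (L.Rt)[X]) :
    L.frobPoly (L.actPoly γ x) = L.actPoly γ (L.frobPoly x) := by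
  have key : algebraMap 𝓡.R L.Rt (L.s • L.a γ) + algebraMap 𝓡.R L.Rt (γ • L.aφ) =
      algebraMap 𝓡.R L.Rt L.aφ + algebraMap 𝓡.R L.Rt (𝓡.frob (L.a γ)) := by
    rw [← map_add, ← map_add, L.frob_a]
  have hs : algebraMap 𝓡.R L.Rt (L.s • L.a γ) = algebraMap E L.Rt L.s * algebraMap 𝓡.R L.Rt (L.a γ) := by
    rw [Algebra.smul_def, map_mul, ← IsScalarTower.algebraMap_apply]
  rw [hs] at key
  have key' := congrArg (C : L.Rt →+* (L.Rt)[X]) key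
  simp only [map_add, map_mul] at key'
  have h : L.frobPoly.comp (L.actPoly γ) = (L.actPoly γ).comp L.frobPoly := by
    refine Polynomial.algHom_ext' (AlgHom.ext fun r => ?_) ?_
    · simp [TDatum.smul_def]
      rw [← TDatum.smul_def, ← TDatum.smul_def, TDatum.frobRt_smul]
    · simp only [AlgHom.coe_comp, Function.comp_apply, actPoly_X, frobPoly_X, map_add, map_mul,
        frobPoly_C, actPoly_C, TDatum.frobRt_algebraMap, TDatum.smul_algebraMap, smul_algebraMap]
      linear_combination -key'
  exact congr($h x)

/-- **The monodromy operator `N = ν · d/dℓ`** on `R[1/t][ℓ]` (an `R[1/t]`-linear derivation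
killing `R[1/t]`; Berger: `N = -d/d log(π)`, renormalised by `N(log π) = -p/(p-1)` to give
Fontaine's `N`). [cite: BergerLaurent2002, §2.4],
[cite: Berger2008PhiNFiltres, §III and Appendix (errata to [Ber02])] -/
def nPoly : (L.Rt)[X] →ₗ[L.Rt] (L.Rt)[X] :=
  algebraMap E L.Rt L.ν • (Polynomial.derivative : (L.Rt)[X] →ₗ[L.Rt] (L.Rt)[X])

/-- Unfolding lemma: `N x = ν · x'`. [folklore] -/
lemma nPoly_apply (x : (L.Rt)[X]) :
    L.nPoly x = C (algebraMap E L.Rt L.ν) * Polynomial.derivative x := by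
  rw [nPoly, LinearMap.smul_apply, Polynomial.smul_eq_C_mul]

/-- `N` kills `R[1/t]`. [cite: BergerLaurent2002, §2.4] -/
@[simp] lemma nPoly_C (r : L.Rt) : L.nPoly (C r) = 0 := by simp [nPoly_apply]

/-- `N(ℓ) = ν`. [cite: Berger2008PhiNFiltres, §III] -/
@[simp] lemma nPoly_X : L.nPoly X = C (algebraMap E L.Rt L.ν) := by simp [nPoly_apply]

/-- `N` commutes with `Γ`. [cite: BergerLaurent2002, §2.4 ("`N` commute à l'action de `G_F`")] -/
lemma nPoly_actPoly (γ : Γ) (x : (L.Rt)[X]) : L.nPoly (L.actPoly γ x) = L.actPoly γ (L.nPoly x) := by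
  rw [actPoly_apply, actPoly_apply, nPoly_apply, nPoly_apply, Polynomial.derivative_comp, actX,
    Polynomial.derivative_add, Polynomial.derivative_X, Polynomial.derivative_C, add_zero, one_mul,
    Polynomial.derivative_map, Polynomial.map_mul, Polynomial.map_C, Polynomial.mul_comp,
    Polynomial.C_comp]
  congr 2
  exact (AlgHom.commutes (L.actRt γ) _).symm

/-- `N φ = s φ N` (intended `s = p`: Fontaine's relation `N φ = p φ N`).
[cite: BergerLaurent2002, §1.2 (`N φ = p φ N`)] -/
lemma nPoly_frobPoly (x : (L.Rt)[X]) :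
    L.nPoly (L.frobPoly x) = C (algebraMap E L.Rt L.s) * L.frobPoly (L.nPoly x) := by
  rw [frobPoly_apply, frobPoly_apply, nPoly_apply, nPoly_apply, Polynomial.derivative_comp, frobX,
    Polynomial.derivative_add, Polynomial.derivative_C, add_zero, Polynomial.derivative_C_mul,
    Polynomial.derivative_X, mul_one, Polynomial.derivative_map, Polynomial.map_mul,
    Polynomial.map_C, Polynomial.mul_comp, Polynomial.C_comp]
  have h : (L.frobRt : L.Rt →+* L.Rt) (algebraMap E L.Rt L.ν) = algebraMap E L.Rt L.ν :=
    AlgHom.commutes L.frobRt _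
  rw [h]
  ring

/-! ### The ring `R[1/t][log π]` as a type with Berger's action of `Γ` -/

/-- **The ring `R[1/t][log π]`** (`= B_log[1/t]` with coefficients, for the Robba ring): a type
synonym of the polynomial ring `R[1/t][X]`, `X = ℓ = log π`, carrying BERGER's action of `Γ`
(`γ(ℓ) = ℓ + a_γ`) — and not Mathlib's coefficientwise action of `Γ` on polynomials, which the
synonym hides. [cite: BergerLaurent2002, §2.6 and Thm. 0.2] -/
def LogRing : Type w := (L.Rt)[X]

/-- Ring structure of `R[1/t][log π]` (that of `R[1/t][X]`). [folklore] -/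
instance commRing_LogRing : CommRing L.LogRing := inferInstanceAs (CommRing (L.Rt)[X])
/-- `R[1/t][log π] ≠ 0`. [folklore] -/
instance nontrivial_LogRing : Nontrivial L.LogRing := inferInstanceAs (Nontrivial (L.Rt)[X])
/-- `R[1/t][log π]` is an `E`-algebra (coefficients). [folklore] -/
instance algebraE_LogRing : Algebra E L.LogRing := inferInstanceAs (Algebra E (L.Rt)[X])
/-- `R[1/t][log π]` is an `R[1/t]`-algebra. [folklore] -/
instance algebraRt_LogRing : Algebra L.Rt L.LogRing := inferInstanceAs (Algebra L.Rt (L.Rt)[X])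
/-- `R[1/t][log π]` is an `R`-algebra. [folklore] -/
instance algebraR_LogRing : Algebra 𝓡.R L.LogRing := inferInstanceAs (Algebra 𝓡.R (L.Rt)[X])
/-- Tower `E → R → R[1/t][log π]`. [folklore] -/
instance isScalarTower_E_R_LogRing : IsScalarTower E 𝓡.R L.LogRing :=
  inferInstanceAs (IsScalarTower E 𝓡.R (L.Rt)[X])
/-- Tower `E → R[1/t] → R[1/t][log π]`. [folklore] -/
instance isScalarTower_E_Rt_LogRing : IsScalarTower E L.Rt L.LogRing :=
  inferInstanceAs (IsScalarTower E L.Rt (L.Rt)[X])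
/-- Tower `R → R[1/t] → R[1/t][log π]`. [folklore] -/
instance isScalarTower_R_Rt_LogRing : IsScalarTower 𝓡.R L.Rt L.LogRing :=
  inferInstanceAs (IsScalarTower 𝓡.R L.Rt (L.Rt)[X])
/-- The actions of `R` and `E` on `R[1/t][log π]` commute. [folklore] -/
instance smulCommClass_R_E_LogRing : SMulCommClass 𝓡.R E L.LogRing :=
  inferInstanceAs (SMulCommClass 𝓡.R E (L.Rt)[X])
/-- The actions of `E` and `R` on `R[1/t][log π]` commute. [folklore] -/
instance smulCommClass_E_R_LogRing : SMulCommClass E 𝓡.R L.LogRing :=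
  inferInstanceAs (SMulCommClass E 𝓡.R (L.Rt)[X])

/-- The identification `R[1/t][log π] = R[1/t][X]` (identity). [folklore] -/
def toPoly : L.LogRing ≃ₐ[L.Rt] (L.Rt)[X] := AlgEquiv.refl

/-- The variable `ℓ = log π ∈ R[1/t][log π]`. [cite: BergerLaurent2002, §2.4] -/
def ell : L.LogRing := L.toPoly.symm X

/-- **Berger's action of `Γ` on `R[1/t][log π]`** (`γ` on coefficients, `γ(log π) = log π + a_γ`),
transported from `actPoly`. [cite: BergerLaurent2002, §2.6] -/
instance mulSemiringAction_LogRing : MulSemiringAction Γ L.LogRing where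
  smul γ x := L.toPoly.symm (L.actPoly γ (L.toPoly x))
  one_smul x := show L.toPoly.symm (L.actPoly 1 (L.toPoly x)) = x by rw [actPoly_one]; rfl
  mul_smul γ γ' x := show L.toPoly.symm (L.actPoly (γ * γ') (L.toPoly x)) = _ by
    rw [actPoly_mul]; rfl
  smul_zero γ := show L.toPoly.symm (L.actPoly γ (L.toPoly 0)) = 0 by simp
  smul_add γ x y := show L.toPoly.symm (L.actPoly γ (L.toPoly (x + y))) = _ by simp; rfl
  smul_one γ := show L.toPoly.symm (L.actPoly γ (L.toPoly 1)) = 1 by simp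
  smul_mul γ x y := show L.toPoly.symm (L.actPoly γ (L.toPoly (x * y))) = _ by simp; rfl

/-- Unfolding lemma: `γ` acts on `R[1/t][log π]` through `actPoly`. [folklore] -/
lemma smul_def (γ : Γ) (x : L.LogRing) : γ • x = L.toPoly.symm (L.actPoly γ (L.toPoly x)) := rfl

/-- Unfolding lemma on the polynomial side: `toPoly (γ • x) = actPoly γ (toPoly x)`. [folklore] -/
@[simp] lemma toPoly_smul (γ : Γ) (x : L.LogRing) : L.toPoly (γ • x) = L.actPoly γ (L.toPoly x) := rfl

/-- `toPoly` is `E`-linear (it is the identity). [folklore] -/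
@[simp] lemma toPoly_smul_E (e : E) (x : L.LogRing) : L.toPoly (e • x) = e • L.toPoly x := rfl

/-- Berger's action of `Γ` on `R[1/t][log π]` is `E`-linear. [folklore] -/
instance smulCommClass_Γ_E_LogRing : SMulCommClass Γ E L.LogRing where
  smul_comm γ e x := by
    apply L.toPoly.injective
    rw [toPoly_smul, toPoly_smul_E, toPoly_smul_E, toPoly_smul, map_smul]

/-- The Frobenius of `R[1/t][log π]`. [cite: BergerLaurent2002, §2.6] -/
def frobLog : L.LogRing →ₐ[E] L.LogRing :=
  ((L.toPoly.symm : (L.Rt)[X] →ₐ[L.Rt] L.LogRing).restrictScalars E).comp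
    (L.frobPoly.comp ((L.toPoly : L.LogRing →ₐ[L.Rt] (L.Rt)[X]).restrictScalars E))

/-- Unfolding lemma on the polynomial side: `toPoly (φ x) = frobPoly (toPoly x)`. [folklore] -/
@[simp] lemma toPoly_frobLog (x : L.LogRing) : L.toPoly (L.frobLog x) = L.frobPoly (L.toPoly x) := rfl

/-- `φ` commutes with `Γ` on `R[1/t][log π]`. [folklore] -/
lemma frobLog_smul (γ : Γ) (x : L.LogRing) : L.frobLog (γ • x) = γ • L.frobLog x := by
  apply L.toPoly.injective
  rw [toPoly_frobLog, toPoly_smul, toPoly_smul, toPoly_frobLog, frobPoly_actPoly]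

/-- **Monodromy `N`** on `R[1/t][log π]` (`R[1/t]`-linear). [cite: BergerLaurent2002, §2.4] -/
def nLog : L.LogRing →ₗ[L.Rt] L.LogRing :=
  (L.toPoly.symm : (L.Rt)[X] →ₐ[L.Rt] L.LogRing).toLinearMap ∘ₗ L.nPoly ∘ₗ
    (L.toPoly : L.LogRing →ₐ[L.Rt] (L.Rt)[X]).toLinearMap

/-- Unfolding lemma on the polynomial side: `toPoly (N x) = nPoly (toPoly x)`. [folklore] -/
@[simp] lemma toPoly_nLog (x : L.LogRing) : L.toPoly (L.nLog x) = L.nPoly (L.toPoly x) := rfl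

/-- `N` commutes with `Γ` on `R[1/t][log π]`. [cite: BergerLaurent2002, §2.4] -/
lemma nLog_smul (γ : Γ) (x : L.LogRing) : L.nLog (γ • x) = γ • L.nLog x := by
  apply L.toPoly.injective
  rw [toPoly_nLog, toPoly_smul, toPoly_smul, toPoly_nLog, nPoly_actPoly]

/-- `N φ = s φ N` on `R[1/t][log π]`. [cite: BergerLaurent2002, §1.2] -/
lemma nLog_frobLog (x : L.LogRing) : L.nLog (L.frobLog x) = L.s • L.frobLog (L.nLog x) := by
  apply L.toPoly.injective
  rw [toPoly_nLog, toPoly_frobLog, toPoly_smul_E, toPoly_frobLog, toPoly_nLog, nPoly_frobPoly,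
    ← Polynomial.smul_eq_C_mul, algebraMap_smul]

/-- `N` kills `R[1/t]` (the coefficients). [cite: BergerLaurent2002, §2.4] -/
@[simp] lemma nLog_algebraMap (r : L.Rt) : L.nLog (algebraMap L.Rt L.LogRing r) = 0 := by
  apply L.toPoly.injective
  rw [toPoly_nLog, AlgEquiv.commutes, Polynomial.algebraMap_eq, nPoly_C, map_zero]

/-- `N(ℓ) = ν`. [cite: Berger2008PhiNFiltres, §III] -/
@[simp] lemma nLog_ell : L.nLog L.ell = algebraMap E L.LogRing L.ν := by
  apply L.toPoly.injective
  rw [toPoly_nLog, ell, AlgEquiv.apply_symm_apply, nPoly_X,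
    IsScalarTower.algebraMap_apply E L.Rt L.LogRing, AlgEquiv.commutes, Polynomial.algebraMap_eq]

end LogDatum

/-- **The `(φ, Γ)`-ring `𝓡[1/t][log π]`** (`B_log,K[1/t]` with coefficients, for the Robba
ring): `R[1/t][ℓ]`, `ℓ = log π`, with `φ(ℓ) = s ℓ + a_φ`, `γ(ℓ) = ℓ + a_γ`; it carries the
monodromy `LogDatum.nLog`.  Reducible (see `away`). [cite: BergerLaurent2002, §2.6 and Thm. 0.2] -/
@[reducible] def logRing (L : 𝓡.LogDatum) : PhiGammaRing.{u, v, w} Γ E where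
  R := L.LogRing
  frob := L.frobLog
  frob_smul := L.frobLog_smul

/-- Unfolding lemma: the Frobenius of `𝓡[1/t][log π]` is `frobLog`. [folklore] -/
lemma logRing_frob_apply (L : 𝓡.LogDatum) (x : L.LogRing) :
    (𝓡.logRing L).frob x = L.frobLog x := rfl

/-- `algebraMap R (R[1/t][log π])` on the polynomial side. [folklore] -/
lemma LogDatum.toPoly_algebraMap (L : 𝓡.LogDatum) (r : 𝓡.R) :
    L.toPoly (algebraMap 𝓡.R L.LogRing r) = C (algebraMap 𝓡.R L.Rt r) :=
  Polynomial.algebraMap_apply r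

/-- `𝓡[1/t][log π]` is an extension of `𝓡`. [folklore] -/
instance isExtension_logRing (L : 𝓡.LogDatum) : 𝓡.IsExtension (𝓡.logRing L) where
  algebraMap_frob r := by
    apply L.toPoly.injective
    rw [LogDatum.toPoly_algebraMap, logRing_frob_apply, LogDatum.toPoly_frobLog,
      LogDatum.toPoly_algebraMap, LogDatum.frobPoly_C, TDatum.frobRt_algebraMap]
  algebraMap_smul γ r := by
    apply L.toPoly.injective
    rw [LogDatum.toPoly_algebraMap, LogDatum.toPoly_smul, LogDatum.toPoly_algebraMap,
      LogDatum.actPoly_C, TDatum.smul_algebraMap]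

/-- `𝓡[1/t][log π]` is an extension of `𝓡[1/t]`. [folklore] -/
instance isExtension_away_logRing (L : 𝓡.LogDatum) :
    (𝓡.away L.toTDatum).IsExtension (𝓡.logRing L) where
  algebraMap_frob r := by
    apply L.toPoly.injective
    rw [AlgEquiv.commutes, logRing_frob_apply, LogDatum.toPoly_frobLog, AlgEquiv.commutes,
      Polynomial.algebraMap_eq, LogDatum.frobPoly_C, away_frob_apply]
  algebraMap_smul γ r := by
    apply L.toPoly.injective
    rw [AlgEquiv.commutes, LogDatum.toPoly_smul, AlgEquiv.commutes, Polynomial.algebraMap_eq,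
      LogDatum.actPoly_C]

end PhiGammaRing

/-! ## Part D. Stable submodules, quotients; `D_cris`, `D_st`, `φ`, `N` -/

namespace PhiGammaModule

variable {Γ : Type u} [Group Γ] {E : Type v} [CommRing E] {𝓡 : PhiGammaRing.{u, v, w} Γ E}
  {D : Type x} [AddCommGroup D] [Module 𝓡.R D] (M : PhiGammaModule 𝓡 D)

/-! ### Sub- and quotient `(φ, Γ)`-modules by a stable submodule -/

section SubQuot

variable (N : Submodule 𝓡.R D) (hN : M.IsStable N)

/-- The `(φ, Γ)`-module structure on a **stable submodule** `N ⊆ D` (`φ(N) ⊆ N`, `γ(N) ⊆ N`).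
[cite: KedlayaPottharstXiao2014, Def. 6.3.1] -/
def restrict : PhiGammaModule 𝓡 N where
  phi := ((M.phiₛₗ.domRestrict N).codRestrict N fun x => hN.1 x.1 x.2).toAddMonoidHom
  phi_smul r x := Subtype.ext (M.phi_smul r x)
  act γ := (((M.actₛₗ γ).domRestrict N).codRestrict N fun x => hN.2 γ x.1 x.2).toAddMonoidHom
  act_one := AddMonoidHom.ext fun x => Subtype.ext (M.act_one_apply x)
  act_mul γ γ' := AddMonoidHom.ext fun x => Subtype.ext (M.act_mul_apply γ γ' x)
  act_smul γ r x := Subtype.ext (M.act_smul γ r x)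
  phi_act γ x := Subtype.ext (M.phi_act γ x)

/-- Unfolding lemma: `φ` on a stable submodule (values). [folklore] -/
@[simp] lemma coe_restrict_phi (x : N) : ((M.restrict N hN).phi x : D) = M.phi x := rfl

/-- Unfolding lemma: `γ` on a stable submodule (values). [folklore] -/
@[simp] lemma coe_restrict_act (γ : Γ) (x : N) : ((M.restrict N hN).act γ x : D) = M.act γ x := rfl

/-- The `(φ, Γ)`-module structure on the **quotient** `D ⧸ N` by a stable submodule (e.g. the
graded pieces `Fil_j / Fil_i` of a triangulation, Ding's `D_i^j`).
[cite: KedlayaPottharstXiao2014, Def. 6.3.1], [cite: Ding2019SimpleL, §3.1 (`D_i^j := Fil^j D / Fil^i D`)] -/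
def quotient : PhiGammaModule 𝓡 (D ⧸ N) where
  phi := (N.mapQ N M.phiₛₗ fun x hx => hN.1 x hx).toAddMonoidHom
  phi_smul r z := by
    induction z using Submodule.Quotient.induction_on with
    | H x => exact congrArg (Submodule.Quotient.mk (p := N)) (M.phi_smul r x)
  act γ := (N.mapQ N (M.actₛₗ γ) fun x hx => hN.2 γ x hx).toAddMonoidHom
  act_one := by
    refine AddMonoidHom.ext fun z => ?_
    induction z using Submodule.Quotient.induction_on with
    | H x => exact congrArg (Submodule.Quotient.mk (p := N)) (M.act_one_apply x)
  act_mul γ γ' := by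
    refine AddMonoidHom.ext fun z => ?_
    induction z using Submodule.Quotient.induction_on with
    | H x => exact congrArg (Submodule.Quotient.mk (p := N)) (M.act_mul_apply γ γ' x)
  act_smul γ r z := by
    induction z using Submodule.Quotient.induction_on with
    | H x => exact congrArg (Submodule.Quotient.mk (p := N)) (M.act_smul γ r x)
  phi_act γ z := by
    induction z using Submodule.Quotient.induction_on with
    | H x => exact congrArg (Submodule.Quotient.mk (p := N)) (M.phi_act γ x)

/-- Unfolding lemma: `φ` on the quotient of classes. [folklore] -/
@[simp] lemma quotient_phi_mk (x : D) :
    (M.quotient N hN).phi (Submodule.Quotient.mk x) = Submodule.Quotient.mk (M.phi x) := rfl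

/-- Unfolding lemma: `γ` on the quotient of classes. [folklore] -/
@[simp] lemma quotient_act_mk (γ : Γ) (x : D) :
    (M.quotient N hN).act γ (Submodule.Quotient.mk x) = Submodule.Quotient.mk (M.act γ x) := rfl

end SubQuot

/-! ### `D_cris(D) = (D[1/t])^Γ` -/

section Cris

variable (T : 𝓡.TDatum)

/-- `D[1/t] = R[1/t] ⊗_R D` with its `(φ, Γ)`-structure. [cite: BergerLaurent2002, Thm. 0.2] -/
abbrev awayT : PhiGammaModule (𝓡.away T) (T.Rt ⊗[𝓡.R] D) := M.extendScalars (𝓡.away T)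

/-- Unfolding lemma: `φ(a ⊗ x) = φ(a) ⊗ φ_D(x)` on `D[1/t]` (keyed on the concrete ring, for
`simp`). [folklore] -/
@[simp] lemma awayT_phi_tmul (a : T.Rt) (x : D) :
    (M.awayT T).phi (a ⊗ₜ x) = T.frobRt a ⊗ₜ M.phi x := rfl

/-- Unfolding lemma: `γ(a ⊗ x) = γ(a) ⊗ γ(x)` on `D[1/t]`. [folklore] -/
@[simp] lemma awayT_act_tmul (γ : Γ) (a : T.Rt) (x : D) :
    (M.awayT T).act γ (a ⊗ₜ x) = (γ • a) ⊗ₜ M.act γ x := rfl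

/-- **Berger's `D_cris(D) := (D[1/t])^Γ`**, the `E`-submodule of `D[1/t] = R[1/t] ⊗_R D` fixed by
all of `Γ` (for `D = D_rig(V)` over the Robba ring this is Fontaine's `D_cris(V)`, Berger 2002
Thm. 0.2 / Thm. 3.6; for a general `(φ, Γ)`-module over the Robba ring it is the definition of
`D_cris(D)`). [cite: BergerLaurent2002, Thm. 0.2] -/
def Dcris : Submodule E (T.Rt ⊗[𝓡.R] D) := (M.awayT T).invariants Set.univ

/-- Membership in `D_cris(D)`: fixed by every `γ ∈ Γ`. [folklore] -/
lemma mem_Dcris_iff (z : T.Rt ⊗[𝓡.R] D) : z ∈ M.Dcris T ↔ ∀ γ : Γ, (M.awayT T).act γ z = z := by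
  simp [Dcris, mem_invariants_iff]

/-- **The Frobenius of `D_cris(D)`** (restriction of `φ ⊗ φ_D`; it commutes with `Γ`).
[cite: BergerLaurent2002, §0.2 ("permet de retrouver les actions de `φ` et `N`")] -/
def phiDcris : M.Dcris T →ₗ[E] M.Dcris T := (M.awayT T).phiInv Set.univ

/-- Unfolding lemma for `phiDcris` (values). [folklore] -/
@[simp] lemma coe_phiDcris_apply (z : M.Dcris T) :
    ((M.phiDcris T z : M.Dcris T) : T.Rt ⊗[𝓡.R] D) = (M.awayT T).phi z := rfl

/-- The natural map `D → D[1/t]`, `x ↦ 1 ⊗ x` (`R`-linear). [folklore] -/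
def toAwayT : D →ₗ[𝓡.R] T.Rt ⊗[𝓡.R] D := TensorProduct.mk 𝓡.R T.Rt D 1

/-- Unfolding lemma for `toAwayT`. [folklore] -/
@[simp] lemma toAwayT_apply (x : D) : toAwayT T x = (1 : T.Rt) ⊗ₜ x := rfl

/-- **`D` is crystalline** (relative to Berger's `t` and the absolute inertia degree `f`, INTENDED
`f = [F₀ : ℚ_p]`, `F₀ = (R[1/t])^Γ` the maximal absolutely unramified subfield of `F`):
`dim_E D_cris(D) = f · rk_R(D)`, i.e. `D_cris(D)` is an `F₀`-vector space of dimension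
`[E:ℚ_p] · rk`, Berger's "`(D_rig(V)[1/t])^{Γ_K}` est un `F`-espace vectoriel de dimension
`d = dim_{ℚ_p} V`" (for general `D` the dimension is at most this, and equality is the definition
of crystalline). [cite: BergerLaurent2002, Thm. 3.6 (= Thm. 0.2) and §3.2] -/
def IsCrystalline (f : ℕ) : Prop :=
  Module.finrank E (M.Dcris T) = f * Module.finrank 𝓡.R D

end Cris

/-! ### `D_st(D) = (D[1/t][log π])^Γ` with `φ` and `N` -/

section St

variable (L : 𝓡.LogDatum)

/-- `D_log[1/t] = R[1/t][log π] ⊗_R D` with its `(φ, Γ)`-structure (Berger's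
`D_log(V) = B_log,K ⊗ D(V)`, localised at `t`). [cite: BergerLaurent2002, §3.2 and Thm. 0.2] -/
abbrev logAway : PhiGammaModule (𝓡.logRing L) (L.LogRing ⊗[𝓡.R] D) := M.extendScalars (𝓡.logRing L)

/-- Unfolding lemma: `φ(a ⊗ x) = φ(a) ⊗ φ_D(x)` on `D[1/t][log π]` (keyed on the concrete ring,
for `simp`). [folklore] -/
@[simp] lemma logAway_phi_tmul (a : L.LogRing) (x : D) :
    (M.logAway L).phi (a ⊗ₜ x) = L.frobLog a ⊗ₜ M.phi x := rfl

/-- Unfolding lemma: `γ(a ⊗ x) = γ(a) ⊗ γ(x)` on `D[1/t][log π]`. [folklore] -/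
@[simp] lemma logAway_act_tmul (γ : Γ) (a : L.LogRing) (x : D) :
    (M.logAway L).act γ (a ⊗ₜ x) = (γ • a) ⊗ₜ M.act γ x := rfl

/-- **Berger's `D_st(D) := (D[1/t][log π])^Γ`**, the `E`-submodule of `R[1/t][log π] ⊗_R D`
fixed by all of `Γ` (for `D = D_rig(V)`: Fontaine's `D_st(V)`, Berger 2002 Thm. 0.2 / Thm. 3.6:
"`D_st(V) = (D_log(V)[1/t])^{Γ_K}`"). [cite: BergerLaurent2002, Thm. 0.2] -/
def Dst : Submodule E (L.LogRing ⊗[𝓡.R] D) := (M.logAway L).invariants Set.univ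

/-- Membership in `D_st(D)`: fixed by every `γ ∈ Γ`. [folklore] -/
lemma mem_Dst_iff (z : L.LogRing ⊗[𝓡.R] D) : z ∈ M.Dst L ↔ ∀ γ : Γ, (M.logAway L).act γ z = z := by
  simp [Dst, mem_invariants_iff]

/-- **The Frobenius of `D_st(D)`** (restriction of `φ ⊗ φ_D`). [cite: BergerLaurent2002, §0.2] -/
def phiDst : M.Dst L →ₗ[E] M.Dst L := (M.logAway L).phiInv Set.univ

/-- Unfolding lemma for `phiDst` (values). [folklore] -/
@[simp] lemma coe_phiDst_apply (z : M.Dst L) :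
    ((M.phiDst L z : M.Dst L) : L.LogRing ⊗[𝓡.R] D) = (M.logAway L).phi z := rfl

/-- The monodromy `N ⊗ 1` on `R[1/t][log π] ⊗_R D` (`N` is `R[1/t]`-linear, a fortiori
`R`-linear, so `N ⊗ 1` is defined), as an `E`-linear map. [cite: BergerLaurent2002, §2.4 and §0.2] -/
def nLogAway : L.LogRing ⊗[𝓡.R] D →ₗ[E] L.LogRing ⊗[𝓡.R] D :=
  (TensorProduct.map (L.nLog.restrictScalars 𝓡.R) LinearMap.id).restrictScalars E

/-- Unfolding lemma: `(N ⊗ 1)(a ⊗ x) = N(a) ⊗ x`. [folklore] -/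
@[simp] lemma nLogAway_tmul (a : L.LogRing) (x : D) : nLogAway L (a ⊗ₜ[𝓡.R] x) = L.nLog a ⊗ₜ x := rfl

/-- `N ⊗ 1` commutes with `Γ`. [cite: BergerLaurent2002, §2.4] -/
lemma nLogAway_act (γ : Γ) (z : L.LogRing ⊗[𝓡.R] D) :
    nLogAway L ((M.logAway L).act γ z) = (M.logAway L).act γ (nLogAway L z) := by
  induction z using TensorProduct.induction_on with
  | zero => simp
  | tmul a x => simp [L.nLog_smul]
  | add z z' hz hz' => simp only [map_add, hz, hz']

/-- `(N ⊗ 1) ∘ φ = s · φ ∘ (N ⊗ 1)` (intended `s = p`). [cite: BergerLaurent2002, §1.2 (`N φ = p φ N`)] -/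
lemma nLogAway_phi (z : L.LogRing ⊗[𝓡.R] D) :
    nLogAway L ((M.logAway L).phi z) = L.s • (M.logAway L).phi (nLogAway L z) := by
  induction z using TensorProduct.induction_on with
  | zero => simp
  | tmul a x => simp [L.nLog_frobLog, TensorProduct.smul_tmul']
  | add z z' hz hz' => simp only [map_add, hz, hz', smul_add]

/-- **The monodromy operator `N` of `D_st(D)`** (restriction of `N ⊗ 1`, which commutes with
`Γ`). [cite: BergerLaurent2002, §0.2 and §2.4] -/
def nDst : M.Dst L →ₗ[E] M.Dst L :=
  (nLogAway L).restrict fun z hz => by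
    rw [mem_Dst_iff] at hz ⊢
    intro γ
    rw [← nLogAway_act, hz]

/-- Unfolding lemma for `nDst` (values). [folklore] -/
@[simp] lemma coe_nDst_apply (z : M.Dst L) :
    ((M.nDst L z : M.Dst L) : L.LogRing ⊗[𝓡.R] D) = nLogAway L z := rfl

/-- **Fontaine's relation `N φ = p φ N` on `D_st(D)`** (with the datum's scalar `s`, intended
`s = p`). [cite: BergerLaurent2002, §1.2] -/
theorem nDst_comp_phiDst : M.nDst L ∘ₗ M.phiDst L = L.s • (M.phiDst L ∘ₗ M.nDst L) := by
  refine LinearMap.ext fun z => Subtype.ext ?_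
  simp only [LinearMap.coe_comp, Function.comp_apply, coe_nDst_apply, coe_phiDst_apply,
    LinearMap.smul_apply, Submodule.coe_smul]
  exact M.nLogAway_phi L z

/-- **`D` is semistable** (relative to the log datum and the absolute inertia degree `f`,
INTENDED `f = [F₀ : ℚ_p]`): `dim_E D_st(D) = f · rk_R(D)` — Berger: "`V` est semi-stable si et
seulement si `(D_log(V)[1/t])^{Γ_K}` est un `F`-espace vectoriel de dimension `d = dim_{ℚ_p} V`";
for a general `(φ, Γ)`-module over the Robba ring this equality is the definition of semistable.
[cite: BergerLaurent2002, Thm. 3.6 (= Thm. 0.2)] -/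
def IsSemistable (f : ℕ) : Prop :=
  Module.finrank E (M.Dst L) = f * Module.finrank 𝓡.R D

end St

/-! ### The rank-two consecutive subquotients `D_i^{i+1}` of a triangulation -/

namespace Triangulation

variable {M} {n : ℕ} (T : M.Triangulation n)

/-- `Fil_i`, seen inside `Fil_{i+2}`, is stable for the restricted structure. [folklore] -/
lemma isStable_comap_Fil (i : ℕ) :
    (M.restrict (T.Fil (i + 2)) (T.isStable_Fil (i + 2))).IsStable
      ((T.Fil i).comap (T.Fil (i + 2)).subtype) :=
  ⟨fun _ hx => Submodule.mem_comap.2 (T.phi_mem_Fil i (Submodule.mem_comap.1 hx)),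
    fun γ _ hx => Submodule.mem_comap.2 (T.act_mem_Fil γ i (Submodule.mem_comap.1 hx))⟩

/-- **Ding's `D_i^{i+1}`**: the rank-two consecutive subquotient `Fil_{i+2} / Fil_i` of a
triangulated `(φ, Γ)`-module (graded pieces `gr_i`, `gr_{i+1}`), as a `(φ, Γ)`-module.
[cite: Ding2019SimpleL, §3.1 (`D_i^j := Fil^j D / Fil^i D`)] -/
def gradedPair (i : ℕ) :
    PhiGammaModule 𝓡 (↥(T.Fil (i + 2)) ⧸ (T.Fil i).comap (T.Fil (i + 2)).subtype) :=
  (M.restrict (T.Fil (i + 2)) (T.isStable_Fil (i + 2))).quotient _ (T.isStable_comap_Fil i)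

end Triangulation

end PhiGammaModule

/-! ## Part E. The Robba-ring datum with Berger's log structure; Ding's criteria and the
comparison with `WD ∘ D_pst` as predicates -/

section Robba

open PhiGammaModule

/-- A `ℚ_p`-algebra which is a field has characteristic zero. [folklore] -/
lemma charZero_of_padicAlgebra (p : ℕ) [Fact p.Prime] (E : Type v) [Field E] [Algebra ℚ_[p] E] :
    CharZero E :=
  charZero_of_injective_algebraMap (algebraMap ℚ_[p] E).injective

/-- `p` as a unit of the coefficient field `E ⊇ ℚ_p`. [folklore] -/
def pUnit (p : ℕ) [Fact p.Prime] (E : Type v) [Field E] [Algebra ℚ_[p] E] : Eˣ :=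
  Units.mk0 (p : E) (by
    haveI := charZero_of_padicAlgebra p E
    exact_mod_cast (Fact.out : p.Prime).ne_zero)

/-- Unfolding lemma: `(pUnit : E) = p`. [folklore] -/
@[simp] lemma coe_pUnit (p : ℕ) [Fact p.Prime] (E : Type v) [Field E] [Algebra ℚ_[p] E] :
    ((pUnit p E : Eˣ) : E) = p := rfl

/-- The `p`-adic cyclotomic character with values in `Eˣ` (`ℤ_pˣ → ℚ_p → E`).
[cite: BergerLaurent2002, §0.2 (`γ(t) = χ(γ) t`)] -/
def cyclotomicUnits (p : ℕ) [Fact p.Prime] (F : Type u) [Field F] (E : Type v) [Field E]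
    [Algebra ℚ_[p] E] : Field.absoluteGaloisGroup F →* Eˣ :=
  (Units.map (((algebraMap ℚ_[p] E).comp (PadicInt.Coe.ringHom (p := p)) : ℤ_[p] →+* E) :
      ℤ_[p] →* E)).comp
    (GaloisRep.cyclotomicCharacter F p).toMonoidHom

variable (p : ℕ) [Fact p.Prime] (F : Type u) [Field F] [TopologicalSpace F]
  (E : Type v) [Field E] [TopologicalSpace E] [IsTopologicalRing E] [Algebra ℚ_[p] E]

/-- **The `(φ, Γ_F)`-module theory over `𝓡_E(π_F)` with Berger's log structure**: the enriched
datum `PhiGammaModuleRobba p F E` (KPX's theory: `𝓡_E(π_F)`, `D_rig`, `𝓡(δ)`, Herr cohomology,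
`homToH1`, …) EXTENDED by the elements of the Robba ring that Berger's `D_cris / D_st` need:
`t = log(1 + π)` (a non-zero-divisor with `φ(t) = p t`, `σ(t) = χ_cyc(σ) t`) and the logarithms
`logFrob = log(φ(π)/π^p)`, `logAct σ = log(σ(π)/π)` defining `B_log = B_rig[log π]`
(`φ(log π) = p log π + log(φ(π)/π^p)`, `σ(log π) = log π + log(σ(π)/π)`), with the two relations
that make `φ` and `Γ_F` act compatibly on `B_log`.  PLACEHOLDER STATUS as for the structure it
extends: the fields are abstract; the intended instance is Berger's.  From it: `tDatum`,
`logDatum` (with `s = p` and Fontaine's normalisation `N(log π) = -p/(p-1)`), hence `D_cris`,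
`D_st`, `φ`, `N`, `IsCrystalline`, `IsSemistable` for every `(φ, Γ)`-module over `𝓣.ring`.
[cite: BergerLaurent2002, §0.2, §2.4, §2.6 and Thm. 0.2],
[cite: Berger2008PhiNFiltres, §III and Appendix (errata to [Ber02])] -/
structure PhiGammaModuleRobbaLog extends PhiGammaModuleRobba.{u, v, w} p F E where
  /-- Berger's `t = log(1 + π) ∈ 𝓡_E(π_F)`. -/
  t : ring.R
  /-- `t` is a non-zero-divisor of the Robba ring. -/
  t_mem : t ∈ nonZeroDivisors ring.R
  /-- `φ(t) = p t`. -/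
  frob_t : ring.frob t = (p : ring.R) * t
  /-- `σ(t) = χ_cyc(σ) t`. -/
  smul_t : ∀ σ : Field.absoluteGaloisGroup F,
    σ • t = algebraMap E ring.R (cyclotomicUnits p F E σ : Eˣ) * t
  /-- `log(φ(π)/π^p) ∈ 𝓡_E(π_F)` (`= φ(log π) - p log π`). -/
  logFrob : ring.R
  /-- `log(σ(π)/π) ∈ 𝓡_E(π_F)` (`= σ(log π) - log π`). -/
  logAct : Field.absoluteGaloisGroup F → ring.R
  /-- `log((στ)(π)/π) = log(σ(π)/π) + σ(log(τ(π)/π))`. -/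
  logAct_mul : ∀ σ τ : Field.absoluteGaloisGroup F, logAct (σ * τ) = logAct σ + σ • logAct τ
  /-- `σ(φ(log π)) = φ(σ(log π))`: `p log(σπ/π) + σ(log(φπ/π^p)) = log(φπ/π^p) + φ(log(σπ/π))`. -/
  frob_logAct : ∀ σ : Field.absoluteGaloisGroup F,
    (p : ring.R) * logAct σ + σ • logFrob = logFrob + ring.frob (logAct σ)

namespace PhiGammaModuleRobbaLog

variable {p F E} (𝓣 : PhiGammaModuleRobbaLog.{u, v, w} p F E)

/-- Berger's `t` of the datum as a `TDatum` (`α = p`, `c = χ_cyc`). [cite: BergerLaurent2002, §0.2] -/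
def tDatum : 𝓣.ring.TDatum where
  t := 𝓣.t
  t_mem := 𝓣.t_mem
  scalars := PhiGammaRing.RankOneDatum.const (pUnit p E) (cyclotomicUnits p F E)
  frob_t := by rw [𝓣.frob_t, PhiGammaRing.RankOneDatum.const_α, coe_pUnit, map_natCast]
  smul_t σ := by rw [𝓣.smul_t, PhiGammaRing.RankOneDatum.const_c]

/-- Unfolding lemma: the `t` of `tDatum`. [folklore] -/
@[simp] lemma tDatum_t : 𝓣.tDatum.t = 𝓣.t := rfl

/-- Berger's log structure of the datum as a `LogDatum`: `s = p`, `a_φ = logFrob`, `a = logAct`,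
and Fontaine's normalisation `ν = N(log π) = -p/(p-1)`.
[cite: Berger2008PhiNFiltres, §III and Appendix (errata to [Ber02])] -/
def logDatum : 𝓣.ring.LogDatum where
  toTDatum := 𝓣.tDatum
  s := p
  aφ := 𝓣.logFrob
  a := 𝓣.logAct
  a_mul := 𝓣.logAct_mul
  frob_a σ := by
    rw [Nat.cast_smul_eq_nsmul, nsmul_eq_mul]
    exact 𝓣.frob_logAct σ
  ν := -(p : E) / (p - 1)

/-- Unfolding lemma: `s = p`. [folklore] -/
@[simp] lemma logDatum_s : 𝓣.logDatum.s = p := rfl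

/-- Unfolding lemma: `ν = -p/(p-1)`. [folklore] -/
@[simp] lemma logDatum_ν : 𝓣.logDatum.ν = -(p : E) / (p - 1) := rfl

section Modules

variable {D : Type x} [AddCommGroup D] [Module 𝓣.R D] (M : PhiGammaModule 𝓣.ring D)

/-- **`D_cris(D) = (D[1/t])^{Γ_F}`** for a `(φ, Γ)`-module over `𝓡_E(π_F)`.
[cite: BergerLaurent2002, Thm. 0.2] -/
abbrev Dcris : Submodule E (𝓣.tDatum.Rt ⊗[𝓣.R] D) := M.Dcris 𝓣.tDatum

/-- The Frobenius of `D_cris(D)`. [cite: BergerLaurent2002, §0.2] -/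
abbrev phiDcris : 𝓣.Dcris M →ₗ[E] 𝓣.Dcris M := M.phiDcris 𝓣.tDatum

/-- **`D_st(D) = (D[1/t][log π])^{Γ_F}`** for a `(φ, Γ)`-module over `𝓡_E(π_F)`.
[cite: BergerLaurent2002, Thm. 0.2] -/
abbrev Dst : Submodule E (𝓣.logDatum.LogRing ⊗[𝓣.R] D) := M.Dst 𝓣.logDatum

/-- The Frobenius of `D_st(D)`. [cite: BergerLaurent2002, §0.2] -/
abbrev phiDst : 𝓣.Dst M →ₗ[E] 𝓣.Dst M := M.phiDst 𝓣.logDatum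

/-- The monodromy `N` of `D_st(D)` (Fontaine's normalisation). [cite: BergerLaurent2002, §0.2 and §2.4] -/
abbrev nDst : 𝓣.Dst M →ₗ[E] 𝓣.Dst M := M.nDst 𝓣.logDatum

/-- **`N φ = p φ N` on `D_st(D)`.** [cite: BergerLaurent2002, §1.2] -/
theorem nDst_comp_phiDst : 𝓣.nDst M ∘ₗ 𝓣.phiDst M = (p : E) • (𝓣.phiDst M ∘ₗ 𝓣.nDst M) :=
  M.nDst_comp_phiDst 𝓣.logDatum

/-- `D` is **crystalline**: `dim_E D_cris(D) = f · rk D`, `f` the absolute inertia degree of `F`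
(INTENDED `f = [F₀:ℚ_p]`). [cite: BergerLaurent2002, Thm. 3.6] -/
abbrev IsCrystalline (f : ℕ) : Prop := M.IsCrystalline 𝓣.tDatum f

/-- `D` is **semistable**: `dim_E D_st(D) = f · rk D`. [cite: BergerLaurent2002, Thm. 3.6] -/
abbrev IsSemistable (f : ℕ) : Prop := M.IsSemistable 𝓣.logDatum f

end Modules

/-! ### The facts the route uses, as predicates ON the datum (nothing asserted) -/

/-- **Ding's crystalline criterion for special non-split extensions** (`f` = absolute inertia
degree of `F`): for a character `δ` with `dim_E H²(𝓡(δ)) = 1` (equivalently `δ` *special*,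
`δ = ε ∏_σ σ^{k_σ}`, `k_σ ≥ 0`, by [cite: KedlayaPottharstXiao2014, Prop. 6.2.8]) and a framed
rank-two `(φ, Γ_F)`-module `D`, triangular with sub-object `𝓡(δ)` and quotient the unit object,
whose class `[D] ∈ H¹(𝓡(δ))` is non-zero: `D` is crystalline iff every SMOOTH (locally constant)
additive character `ψ ∈ Hom_∞(Fˣ, E)` is orthogonal to `[D]`, i.e. `Hom_∞(Fˣ, E) ⊆ 𝓛(D) := [D]^⊥`
("thus `Hom_∞(L^×, E) ⊆ 𝓛(D)` if and only if `D` is crystalline"). [cite: Ding2019SimpleL, §3.1]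
(A predicate ON the datum `𝓣` — a hypothesis a route may posit, nothing asserted; binder
explicit so that the fact census does not read it as a closed statement.) -/
def HasDingCrystallineCriterion (𝓣 : PhiGammaModuleRobbaLog.{u, v, w} p F E) (f : ℕ) : Prop :=
  ∀ (δ : Fˣ →ₜ* Eˣ), Module.finrank E (𝓣.H2 (𝓣.ofChar δ).toModule) = 1 →
    ∀ (D : FramedPhiGammaModule 𝓣.ring 2)
      (h : D.IsTriangularWith
        (fun i => ((![𝓣.ofChar δ, 1] : Fin 2 → 𝓣.ring.RankOneDatum) i).α)
        (fun i σ => ((![𝓣.ofChar δ, 1] : Fin 2 → 𝓣.ring.RankOneDatum) i).c σ)),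
      𝓣.IsCyclotomic D → D.toPhiGammaModule.IsContinuous →
      (Triangulation.ofTriangular D ![𝓣.ofChar δ, 1] h).IsNonSplitAt 𝓣.gen 0 Nat.one_lt_two →
      (𝓣.IsCrystalline D.toPhiGammaModule f ↔
        ∀ ψ : HomCont F E, IsLocallyConstant (ψ : Fˣ → E) →
          𝓣.H1toH1 (PhiGammaModule.unit 𝓣.ring) (𝓣.homToH1 ψ) ∈
            ((Triangulation.ofTriangular D ![𝓣.ofChar δ, 1] h).ratioParam 0
                Nat.one_lt_two).toModule.cupOrthogonal 𝓣.gen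
              ((Triangulation.ofTriangular D ![𝓣.ofChar δ, 1] h).gradedClass 𝓣.gen 0
                Nat.one_lt_two))

/-- **Ding's monodromy criterion (Lemma 3.2)** (`f` = absolute inertia degree of `F`): for a
framed `(φ, Γ_F)`-module `D` of rank `n` with a triangulation all of whose consecutive ratios
`δ_iδ_{i+1}⁻¹` are special (`dim_E H²(𝓡(δ_iδ_{i+1}⁻¹)) = 1`) and all of whose consecutive
extensions are non-split (Ding's *non-critical special* `(D, δ)`), and which is semistable:
`N^{n-1} ≠ 0` on `D_st(D)` iff every consecutive rank-two subquotient `D_i^{i+1}` is semistable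
and not crystalline. [cite: Ding2019SimpleL, Lemma 3.2]
(A predicate ON the datum `𝓣`, nothing asserted; binder explicit for the fact census.) -/
def HasDingMonodromyCriterion (𝓣 : PhiGammaModuleRobbaLog.{u, v, w} p F E) (f : ℕ) : Prop :=
  ∀ (n : ℕ) (D : FramedPhiGammaModule 𝓣.ring n), 𝓣.IsCyclotomic D → D.toPhiGammaModule.IsContinuous →
    ∀ T : D.toPhiGammaModule.Triangulation n,
      (∀ (i : ℕ) (hi : i + 1 < n), Module.finrank E (𝓣.H2 (T.ratioParam i hi).toModule) = 1) →
      (∀ (i : ℕ) (hi : i + 1 < n), T.IsNonSplitAt 𝓣.gen i hi) →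
      𝓣.IsSemistable D.toPhiGammaModule f →
      ((𝓣.nDst D.toPhiGammaModule) ^ (n - 1) ≠ 0 ↔
        ∀ i : ℕ, i + 1 < n →
          𝓣.IsSemistable (T.gradedPair i) f ∧ ¬ 𝓣.IsCrystalline (T.gradedPair i) f)

end PhiGammaModuleRobbaLog

end Robba

/-! ### The comparison with Fontaine's `WD ∘ D_pst` (placeholder `PstWeilDeligneData`) -/

section Comparison

open PhiGammaModule

/-- **Berger's comparison, monodromy part**, between the `(φ, Γ_F)`-module datum with log
structure `𝓣` (coefficients a subfield `ℚ_p ⊆ E₀ ⊆ ℚ̄_p`) and the summit's placeholder datum `𝔓`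
for `WD ∘ D_pst` (`PstWeilDeligneData F p`), `f` the absolute inertia degree of `F`: for every
`ρ : Γ_F →ₜ* GL_n(ℚ̄_p)` with an `E₀`-model `rE` (`HasQlModel`) whose `(φ, Γ_F)`-module
`D_rig(rE)` is semistable, and every Weil–Deligne representation `r` that `𝔓` attaches to `ρ`,
the monodromy `r.N` and the monodromy `N` of `D_st(D_rig(rE))` have the same index of
nilpotency (`r.N^k = 0 ↔ N^k = 0`).  For the genuine data this holds: `V` is semistable iff
`D_rig(V)` is (Berger, Thm. 0.2/3.6: `D_st(V) = (D_log(V)[1/t])^{Γ_K}` as `(φ, N)`-modules), and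
for semistable `V` Fontaine's `WD(V)` is `D_st(V)` linearised along an embedding `F₀ ↪ ℚ̄_p` with
the same `N` [cite: BergerLaurent2002, Thm. 0.2], [cite: FontaineAsterisque223III, Exposé VIII §1.3 and §2.3.7].
Only the monodromy is compared (the Frobenius-semisimplification, which needs the embedding
`F₀ ↪ ℚ̄_p` and `φ^f`, is not rendered).
(A predicate ON the pair of data, nothing asserted; binders explicit for the fact census.) -/
def PhiGammaModuleRobbaLog.IsBergerCompatibleWith {F : Type} [Field F] [ValuativeRel F]
    [TopologicalSpace F] [IsNonarchimedeanLocalField F] {p : ℕ} [Fact p.Prime]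
    {E₀ : IntermediateField ℚ_[p] (PadicAlgCl p)}
    (𝓣 : PhiGammaModuleRobbaLog.{0, 0, w} p F E₀) (𝔓 : PstWeilDeligneData F p) (f : ℕ) : Prop :=
  ∀ (n : ℕ) (ρ : FramedGaloisRep F (PadicAlgCl p) n) (rE : FramedGaloisRep F E₀ n)
    (r : WeilDeligneRep F (PadicAlgCl p) (Fin n → PadicAlgCl p)),
    Literature.NumberTheory.Automorphic.HasQlModel ρ E₀ rE → 𝔓.IsWeilDeligneOf ρ r →
    𝓣.IsSemistable (𝓣.Drig rE).toPhiGammaModule f →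
    ∀ k : ℕ, r.N ^ k = 0 ↔ 𝓣.nDst (𝓣.Drig rE).toPhiGammaModule ^ k = 0

end Comparison

/-- **Requested notion `BergerDstOnPhiGamma`** (item `defn-BergerDstOnPhiGamma`): Berger's `D_st`
of a `(φ, Γ)`-module relative to a log datum, `PhiGammaModule.Dst` (alias for discoverability;
see also `PhiGammaModule.Dcris`, `PhiGammaModule.nDst`, `PhiGammaModuleRobbaLog.Dst`).
[cite: BergerLaurent2002, Thm. 0.2] -/
abbrev BergerDstOnPhiGamma {Γ : Type u} [Group Γ] {E : Type v} [CommRing E]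
    {𝓡 : PhiGammaRing.{u, v, w} Γ E} {D : Type x} [AddCommGroup D] [Module 𝓡.R D]
    (M : PhiGammaModule 𝓡 D) (L : 𝓡.LogDatum) : Submodule E (L.LogRing ⊗[𝓡.R] D) :=
  M.Dst L

end Literature.NumberTheory.GaloisRepresentations

end
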